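import Mathlib

/-!
# Two analytic «standard inferences» of N3 (Fubini on a product of compact spaces for a continuous
integrand; Riesz on a finite-dimensional Hilbert space) — kernel witnesses

Blind cell `pub-hodge-repro2`, seat p4, Tier-5 support. README §8(d): this file uses an
L-value-free non-vanishing device: NO (kernel checks of standard inferences already written out on
the cell's record).

`route/T5-N3-route-2.md` §N3.7(b) (owner route-2) lists, among the standard inferences «written out
(not residuals; each ≤ 1 line, labelled [A] in the rows)»: «Fubini on a product of compact quotients
for a continuous integrand (row T6, N3.L2)» and «Riesz on a finite-dimensional Hilbert space
(N3.L6)». Both are instances of Mathlib theorems; we record the instances in the shape used.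

* `integrable_of_continuous` — a continuous function on a product of two compact spaces is
  integrable for the product of two finite measures (continuous + compact support);
* `integral_integral_swap_of_continuous` — Fubini: the two iterated integrals agree;
* `integral_prod_of_continuous` — the product integral equals the iterated integral;
* `integral_mul_eq` — for a product integrand `φ(x)·ψ(y)` the double integral is the product of
  the two integrals (the shape of N3.L2's pairing of a pure tensor; no hypothesis needed);
* `exists_unique_inner_eq` — Riesz: every linear functional on a finite-dimensional complex inner
  product space is `v ↦ ⟪w, v⟫` for a unique `w` (Mathlib's `InnerProductSpace.toDual`).

The compact quotients `[U(W_A)]`, `[U(V)]` themselves and their Haar measures are NOT modelled;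
the statements take arbitrary compact spaces (second-countable on one factor, as for a compact
manifold) with finite Borel measures.

Mathlib only; no sorry; axioms ⊆ {propext, Classical.choice, Quot.sound}.
-/

namespace Summit.Ventures.HodgeRepro2.T5AnalyticInferences

open MeasureTheory

section Fubini

variable {X Y : Type*} [MeasurableSpace X] [MeasurableSpace Y] (μ : Measure X) (ν : Measure Y)

/-- For a product integrand `φ(x)·ψ(y)` the double integral is the product of the two integrals
(an identity of Bochner integrals with no hypothesis: `integral_const_mul`, `integral_mul_const`). -/
theorem integral_mul_eq (φ : X → ℂ) (ψ : Y → ℂ) :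
    ∫ x, ∫ y, φ x * ψ y ∂ν ∂μ = (∫ x, φ x ∂μ) * ∫ y, ψ y ∂ν := by
  simp_rw [integral_const_mul]
  rw [integral_mul_const]

variable [TopologicalSpace X] [BorelSpace X] [CompactSpace X]
  [TopologicalSpace Y] [BorelSpace Y] [CompactSpace Y] [SecondCountableTopology Y]
  [IsFiniteMeasure μ] [IsFiniteMeasure ν]
  {E : Type*} [NormedAddCommGroup E]

/-- A continuous function on a product of two compact spaces is integrable for the product of two
finite Borel measures. -/
theorem integrable_of_continuous (f : X × Y → E) (hf : Continuous f) : Integrable f (μ.prod ν) :=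
  hf.integrable_of_hasCompactSupport (HasCompactSupport.of_compactSpace f)

variable [NormedSpace ℝ E]

/-- Fubini for a continuous integrand on a product of compact spaces: the iterated integrals agree. -/
theorem integral_integral_swap_of_continuous (f : X → Y → E)
    (hf : Continuous (Function.uncurry f)) :
    ∫ x, ∫ y, f x y ∂ν ∂μ = ∫ y, ∫ x, f x y ∂μ ∂ν :=
  MeasureTheory.integral_integral_swap (integrable_of_continuous μ ν _ hf)

/-- The integral over the product equals the iterated integral, for a continuous integrand. -/
theorem integral_prod_of_continuous (f : X × Y → E) (hf : Continuous f) :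
    ∫ z, f z ∂(μ.prod ν) = ∫ x, ∫ y, f (x, y) ∂ν ∂μ :=
  MeasureTheory.integral_prod f (integrable_of_continuous μ ν f hf)

/-- The integral over the product equals the iterated integral in the other order. -/
theorem integral_prod_symm_of_continuous (f : X × Y → E) (hf : Continuous f) :
    ∫ z, f z ∂(μ.prod ν) = ∫ y, ∫ x, f (x, y) ∂μ ∂ν :=
  MeasureTheory.integral_prod_symm f (integrable_of_continuous μ ν f hf)

end Fubini

section Riesz

variable {H : Type*} [NormedAddCommGroup H] [InnerProductSpace ℂ H]

/-- Uniqueness of a representing vector, in the form used: two vectors with the same inner products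
against every `v` coincide. -/
theorem eq_of_forall_inner_eq {w w' : H} (h : ∀ v : H, inner ℂ w v = inner ℂ w' v) : w = w' :=
  ext_inner_right ℂ h

variable [FiniteDimensional ℂ H]

/-- Riesz representation on a finite-dimensional complex inner product space: every linear
functional `ℓ` is `v ↦ ⟪w, v⟫` for a unique vector `w` (`InnerProductSpace.toDual`; the space is
complete because it is finite-dimensional, and `ℓ` is automatically continuous). -/
theorem exists_unique_inner_eq (ℓ : H →ₗ[ℂ] ℂ) : ∃! w : H, ∀ v : H, ℓ v = inner ℂ w v := by
  let ℓ' : H →L[ℂ] ℂ := LinearMap.toContinuousLinearMap ℓ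
  refine ⟨(InnerProductSpace.toDual ℂ H).symm ℓ', fun v => ?_, fun w hw => ?_⟩
  · rw [InnerProductSpace.toDual_symm_apply]
    rfl
  · refine ext_inner_right ℂ fun v => ?_
    rw [← hw v, InnerProductSpace.toDual_symm_apply]
    rfl

end Riesz

end Summit.Ventures.HodgeRepro2.T5AnalyticInferences
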